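import Summits.CriticalPhenomena.SAWScalingLimit.Theorems.AnnularMassDecay.Negative.Structure

/-!
# Structure of the chain-stopped mass `D(u;s)[N]` (line `radial-renewal-kesten-inequality`, stub S1)

Line `radial-renewal-kesten-inequality` of the crux `AnnularMassDecay` (stmt-CriticalPhenomena-4729),
support for the OPEN stub S1 `stub_chainBounded` (`∃ K₀, D(u;s)[N] ≤ K₀` for all centres `z`, starts
`u`, levels `s ≥ 1`, truncations `N`).  Write `ρ_u = dist (Site.toComplex u) z` and `D(u;s)[N]` for
the `x_c`-mass of the chain-stopped family at level `s` from `u`: self-avoiding `ω` of length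
`0 < n ≤ N`, confined to the open disc of radius `ρ_u` about `z` after time `0`, ending at a strict
radial record of radius `≤ s`, none of whose radial renewal times `0 < t < n` has radius `≤ s`.  All
sums are spelled out over `SAW.Zd.saws`, `SAW.criticalFugacity`, `Site.toComplex`, exactly as in the
registered stub; no definitions here.  The elementary STRUCTURE of `D(u;s)[N]` proved in this file:

* `rr_cb_length_le` — a member has `n ≤ (2⌈ρ_u⌉₊ + 3)²` steps (its vertices after time `0` are
  distinct lattice points of the open disc, boxed by `discBox`);
* `rr_cb_stable` (registered helper) — STABILISATION: `D(u;s)[N] = D(u;s)[N₀]` for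
  `N ≥ N₀ := (2⌈ρ_u⌉₊ + 3)²`, and `rr_cb_le_stable` — `D(u;s)[N] ≤ D(u;s)[N₀]` for every `N`; so the
  `∀ N` of S1 is the single value `N = N₀(u, z)`: each instance `(z, u, s)` is a FINITE family;
* `rr_cb_saturate` — SATURATION IN THE LEVEL: `D(u;s)[N] = D(u;ρ_u)[N]` for `s ≥ ρ_u` (the end
  radius is `< ρ_u` anyway and a renewal before the end is then forbidden at every radius): the
  supremum over `s ≥ 1` in S1 runs over the compact range `1 ≤ s ≤ max 1 ρ_u` and its top value is
  the mass `k(u) = D(u;ρ_u)` of the radially irreducible descents from `u`;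
* `rr_cb_eq_zero_of_near`, `rr_cb_eq_zero_of_neg` — TRIVIAL REGIMES: `D(u;s)[N] = 0` if
  `ρ_u ≤ 1/2` (the first step has length one and cannot get strictly closer) or `s < 0`;
* `rr_cb_floor` — the LATTICE FLOOR: if the closed disc `|· - z| ≤ s` contains exactly one
  lattice point `v`, the level-`s` members are exactly the self-avoiding walks `u → v` of positive
  length confined to the open disc of radius `ρ_u` after time `0` (the end must be `v`, it is then
  automatically a strict record, and no earlier time sits in the closed disc); with `s ≥ 1` that
  disc always holds `≥ 2` lattice points, so this is the regime of levels `< 1` (the levels `ρ_u/A`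
  of the line's seed and skip stubs), where `D(u;s)[N] = Σ_{n ≤ N} #{ω : u → v confined} x_c^n`.

The membership clauses only involve the radius profile `i ↦ dist (Site.toComplex (u + ω i)) z`;
the two equivalences behind saturation and the floor are proved for real sequences first
(`rr_cb_profile_saturate`, `rr_cb_profile_floor`).  Sources: H. Kesten, J. Math. Phys. 4 (1963);
N. Madras, G. Slade, *The Self-Avoiding Walk* (1993) §1.2, §4.2. [folklore]
-/

noncomputable section

namespace Summit.CriticalPhenomena.SAWScalingLimit.Theorems.AnnularMassDecay.Radial

open scoped BigOperators Classical
open Literature.Probability.LatticeModels Literature.Probability.RandomPlanarGeometry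
open Summit.CriticalPhenomena.SAWScalingLimit.Theorems.AnnularMassDecay.Negative
  (criticalFugacity_pos dist_first_step discBox mem_discBox card_discBox)

/-! ### Radius profiles -/

/-- **Saturation, on profiles.** For a profile confined below `ρ` after time `0`, the level-`s` and
level-`s'` membership clauses agree as soon as `ρ ≤ s` and `ρ ≤ s'`: the end clause holds and the
renewal clause forbids every renewal before the end, in both. [folklore] -/
theorem rr_cb_profile_saturate {r : ℕ → ℝ} {ρ s s' : ℝ} {n : ℕ} (hs : ρ ≤ s) (hs' : ρ ≤ s') :
    (0 < n ∧ (∀ i, 0 < i → i ≤ n → r i < ρ) ∧ (∀ i, i < n → r n < r i) ∧ r n ≤ s ∧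
      (∀ t, 0 < t → t < n → (∀ i, i < t → r t < r i) →
        (∀ j, t < j → j ≤ n → r j < r t) → s < r t)) ↔
    (0 < n ∧ (∀ i, 0 < i → i ≤ n → r i < ρ) ∧ (∀ i, i < n → r n < r i) ∧ r n ≤ s' ∧
      (∀ t, 0 < t → t < n → (∀ i, i < t → r t < r i) →
        (∀ j, t < j → j ≤ n → r j < r t) → s' < r t)) := by
  constructor
  · rintro ⟨hn, hconf, hrec, -, hren⟩
    refine ⟨hn, hconf, hrec, ((hconf n hn le_rfl).le.trans hs'), fun t ht0 htn hR hF => ?_⟩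
    have h1 := hren t ht0 htn hR hF
    have h2 := hconf t ht0 htn.le
    linarith
  · rintro ⟨hn, hconf, hrec, -, hren⟩
    refine ⟨hn, hconf, hrec, ((hconf n hn le_rfl).le.trans hs), fun t ht0 htn hR hF => ?_⟩
    have h1 := hren t ht0 htn hR hF
    have h2 := hconf t ht0 htn.le
    linarith

/-- **Lattice floor, on profiles.** If the times of radius `≤ s` among `0, …, n` are exactly the
times where the walk sits at the distinguished point (predicate `atv`), and the walk sits there at
time `n` but at no earlier time, then the level-`s` clauses "end is a strict record of radius `≤ s`,
no renewal of radius `≤ s` before the end" hold. [folklore] -/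
theorem rr_cb_profile_floor {r : ℕ → ℝ} {s : ℝ} {n : ℕ} {atv : ℕ → Prop}
    (hiff : ∀ i, i ≤ n → (r i ≤ s ↔ atv i)) (hend : atv n) (hearly : ∀ i, i < n → ¬ atv i) :
    (∀ i, i < n → r n < r i) ∧ r n ≤ s ∧
      (∀ t, 0 < t → t < n → (∀ i, i < t → r t < r i) →
        (∀ j, t < j → j ≤ n → r j < r t) → s < r t) := by
  have hn : r n ≤ s := (hiff n le_rfl).2 hend
  have hout : ∀ i, i < n → s < r i := fun i hi =>
    lt_of_not_ge fun h => hearly i hi ((hiff i hi.le).1 h)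
  exact ⟨fun i hi => hn.trans_lt (hout i hi), hn, fun t _ htn _ _ => hout t htn⟩

/-! ### Members are short: the truncation stabilises -/

/-- A walk confined to the open disc `|· - z| < R` at the times `1, …, n` has
`n ≤ (2⌈R⌉₊ + 3)²` steps: these vertices are distinct lattice points of the disc, all in
`discBox z R`. [folklore] -/
theorem rr_cb_length_le {z : ℂ} {R : ℝ} {u : Site 2} {n : ℕ} {ω : ℕ → Site 2}
    (hω : ω ∈ SAW.Zd.saws 2 n)
    (hconf : ∀ i, 0 < i → i ≤ n → dist (Site.toComplex (u + ω i)) z < R) :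
    n ≤ (2 * ⌈R⌉₊ + 3) ^ 2 := by
  -- adapted from `length_le_of_counted` (Theorems/AnnularMassDecay/Negative/Structure.lean)
  obtain ⟨-, -, -, hinj⟩ := SAW.Zd.mem_saws.1 hω
  have hmaps : ∀ i ∈ Finset.Ioc 0 n, u + ω i ∈ discBox z R := by
    intro i hi
    rw [Finset.mem_Ioc] at hi
    exact mem_discBox (hconf i hi.1 hi.2)
  have hinj' : Set.InjOn (fun i => u + ω i) (Finset.Ioc 0 n : Set ℕ) := by
    intro i hi j hj h
    have hi' : i ∈ {i | i ≤ n} := by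
      simp only [Finset.coe_Ioc, Set.mem_Ioc] at hi; simp only [Set.mem_setOf_eq]; omega
    have hj' : j ∈ {i | i ≤ n} := by
      simp only [Finset.coe_Ioc, Set.mem_Ioc] at hj; simp only [Set.mem_setOf_eq]; omega
    exact hinj hi' hj' (add_left_cancel h)
  have hcard := Finset.card_le_card_of_injOn (fun i => u + ω i) hmaps hinj'
  rw [card_discBox, Nat.card_Ioc] at hcard
  omega

/-- **Stabilisation in the truncation** (registered helper `rr_cb_stable` for `stub_chainBounded`).
For `N ≥ N₀ := (2⌈dist (Site.toComplex u) z⌉₊ + 3)²` the partial sum `D(u;s)[N]` equals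
`D(u;s)[N₀]`: a member is confined to the open disc of radius `dist (Site.toComplex u) z` about `z`
at the times `1, …, n`, so `n ≤ N₀` (`rr_cb_length_le`).  Hence `∀ N` in S1 may be replaced by the
single value `N₀(u, z)`. [folklore] -/
theorem rr_cb_stable :
    ∀ (z : ℂ) (u : Site 2) (s : ℝ) (N : ℕ), (2 * ⌈dist (Site.toComplex u) z⌉₊ + 3) ^ 2 ≤ N →
      (∑ n ∈ Finset.range (N + 1),
        ∑ _ω ∈ (SAW.Zd.saws 2 n).filter (fun ω =>
          0 < n ∧
          (∀ i, 0 < i → i ≤ n → dist (Site.toComplex (u + ω i)) z < dist (Site.toComplex u) z) ∧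
          (∀ i, i < n → dist (Site.toComplex (u + ω n)) z < dist (Site.toComplex (u + ω i)) z) ∧
          dist (Site.toComplex (u + ω n)) z ≤ s ∧
          (∀ t, 0 < t → t < n →
            (∀ i, i < t → dist (Site.toComplex (u + ω t)) z < dist (Site.toComplex (u + ω i)) z) →
            (∀ j, t < j → j ≤ n → dist (Site.toComplex (u + ω j)) z < dist (Site.toComplex (u + ω t)) z) →
            s < dist (Site.toComplex (u + ω t)) z)),
          SAW.criticalFugacity ^ n) =
      (∑ n ∈ Finset.range ((2 * ⌈dist (Site.toComplex u) z⌉₊ + 3) ^ 2 + 1),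
        ∑ _ω ∈ (SAW.Zd.saws 2 n).filter (fun ω =>
          0 < n ∧
          (∀ i, 0 < i → i ≤ n → dist (Site.toComplex (u + ω i)) z < dist (Site.toComplex u) z) ∧
          (∀ i, i < n → dist (Site.toComplex (u + ω n)) z < dist (Site.toComplex (u + ω i)) z) ∧
          dist (Site.toComplex (u + ω n)) z ≤ s ∧
          (∀ t, 0 < t → t < n →
            (∀ i, i < t → dist (Site.toComplex (u + ω t)) z < dist (Site.toComplex (u + ω i)) z) →
            (∀ j, t < j → j ≤ n → dist (Site.toComplex (u + ω j)) z < dist (Site.toComplex (u + ω t)) z) →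
            s < dist (Site.toComplex (u + ω t)) z)),
          SAW.criticalFugacity ^ n) := by
  intro z u s N hN
  symm
  refine Finset.sum_subset (Finset.range_mono (by omega)) fun n hn hn' => ?_
  rw [Finset.mem_range] at hn hn'
  refine Finset.sum_eq_zero fun ω hω => ?_
  exfalso
  obtain ⟨hsaw, -, hconf, -⟩ := Finset.mem_filter.1 hω
  have := rr_cb_length_le hsaw hconf
  omega

/-- Consequently every partial sum is bounded by the stable one: `D(u;s)[N] ≤ D(u;s)[N₀]` with
`N₀ = (2⌈dist (Site.toComplex u) z⌉₊ + 3)²`; the supremum over `N` in S1 is a maximum, attained at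
`N₀(u, z)`. [folklore] -/
theorem rr_cb_le_stable (z : ℂ) (u : Site 2) (s : ℝ) (N : ℕ) :
    (∑ n ∈ Finset.range (N + 1),
        ∑ _ω ∈ (SAW.Zd.saws 2 n).filter (fun ω =>
          0 < n ∧
          (∀ i, 0 < i → i ≤ n → dist (Site.toComplex (u + ω i)) z < dist (Site.toComplex u) z) ∧
          (∀ i, i < n → dist (Site.toComplex (u + ω n)) z < dist (Site.toComplex (u + ω i)) z) ∧
          dist (Site.toComplex (u + ω n)) z ≤ s ∧
          (∀ t, 0 < t → t < n →
            (∀ i, i < t → dist (Site.toComplex (u + ω t)) z < dist (Site.toComplex (u + ω i)) z) →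
            (∀ j, t < j → j ≤ n → dist (Site.toComplex (u + ω j)) z < dist (Site.toComplex (u + ω t)) z) →
            s < dist (Site.toComplex (u + ω t)) z)),
          SAW.criticalFugacity ^ n) ≤
      (∑ n ∈ Finset.range ((2 * ⌈dist (Site.toComplex u) z⌉₊ + 3) ^ 2 + 1),
        ∑ _ω ∈ (SAW.Zd.saws 2 n).filter (fun ω =>
          0 < n ∧
          (∀ i, 0 < i → i ≤ n → dist (Site.toComplex (u + ω i)) z < dist (Site.toComplex u) z) ∧
          (∀ i, i < n → dist (Site.toComplex (u + ω n)) z < dist (Site.toComplex (u + ω i)) z) ∧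
          dist (Site.toComplex (u + ω n)) z ≤ s ∧
          (∀ t, 0 < t → t < n →
            (∀ i, i < t → dist (Site.toComplex (u + ω t)) z < dist (Site.toComplex (u + ω i)) z) →
            (∀ j, t < j → j ≤ n → dist (Site.toComplex (u + ω j)) z < dist (Site.toComplex (u + ω t)) z) →
            s < dist (Site.toComplex (u + ω t)) z)),
          SAW.criticalFugacity ^ n) := by
  rcases le_or_gt ((2 * ⌈dist (Site.toComplex u) z⌉₊ + 3) ^ 2) N with h | h
  · exact (rr_cb_stable z u s N h).le
  · exact Finset.sum_le_sum_of_subset_of_nonneg (Finset.range_mono (by omega))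
      fun n _ _ => Finset.sum_nonneg fun _ _ => pow_nonneg criticalFugacity_pos.le n

/-! ### Saturation in the level and the trivial regimes -/

/-- **Saturation in the level.** For `s ≥ dist (Site.toComplex u) z` the level-`s` family from `u`
is the level-`dist (Site.toComplex u) z` family — the radially irreducible descents from `u`
(walks confined to the open disc after time `0`, ending at a strict radial record, with NO radial
renewal time before the end): `D(u;s)[N] = D(u;ρ_u)[N] =: k(u)[N]`.  So in S1 only the levels
`1 ≤ s ≤ max 1 ρ_u` matter. [folklore] -/
theorem rr_cb_saturate (z : ℂ) (u : Site 2) (s : ℝ) (N : ℕ) (hs : dist (Site.toComplex u) z ≤ s) :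
    (∑ n ∈ Finset.range (N + 1),
        ∑ _ω ∈ (SAW.Zd.saws 2 n).filter (fun ω =>
          0 < n ∧
          (∀ i, 0 < i → i ≤ n → dist (Site.toComplex (u + ω i)) z < dist (Site.toComplex u) z) ∧
          (∀ i, i < n → dist (Site.toComplex (u + ω n)) z < dist (Site.toComplex (u + ω i)) z) ∧
          dist (Site.toComplex (u + ω n)) z ≤ s ∧
          (∀ t, 0 < t → t < n →
            (∀ i, i < t → dist (Site.toComplex (u + ω t)) z < dist (Site.toComplex (u + ω i)) z) →
            (∀ j, t < j → j ≤ n → dist (Site.toComplex (u + ω j)) z < dist (Site.toComplex (u + ω t)) z) →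
            s < dist (Site.toComplex (u + ω t)) z)),
          SAW.criticalFugacity ^ n) =
      (∑ n ∈ Finset.range (N + 1),
        ∑ _ω ∈ (SAW.Zd.saws 2 n).filter (fun ω =>
          0 < n ∧
          (∀ i, 0 < i → i ≤ n → dist (Site.toComplex (u + ω i)) z < dist (Site.toComplex u) z) ∧
          (∀ i, i < n → dist (Site.toComplex (u + ω n)) z < dist (Site.toComplex (u + ω i)) z) ∧
          dist (Site.toComplex (u + ω n)) z ≤ dist (Site.toComplex u) z ∧
          (∀ t, 0 < t → t < n →
            (∀ i, i < t → dist (Site.toComplex (u + ω t)) z < dist (Site.toComplex (u + ω i)) z) →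
            (∀ j, t < j → j ≤ n → dist (Site.toComplex (u + ω j)) z < dist (Site.toComplex (u + ω t)) z) →
            dist (Site.toComplex u) z < dist (Site.toComplex (u + ω t)) z)),
          SAW.criticalFugacity ^ n) := by
  refine Finset.sum_congr rfl fun n _ => Finset.sum_congr (Finset.filter_congr fun ω _ => ?_)
    fun _ _ => rfl
  exact rr_cb_profile_saturate (r := fun i => dist (Site.toComplex (u + ω i)) z) hs le_rfl

/-- **Trivial regime: starts within `1/2` of the centre.** If `dist (Site.toComplex u) z ≤ 1/2`
no walk is a member — the first step has length one, so time `1` is at distance `≥ 1/2` from `z`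
and cannot be strictly closer than `u` — and `D(u;s)[N] = 0`. [folklore] -/
theorem rr_cb_eq_zero_of_near (z : ℂ) (u : Site 2) (s : ℝ) (N : ℕ)
    (hu : dist (Site.toComplex u) z ≤ 1 / 2) :
    (∑ n ∈ Finset.range (N + 1),
        ∑ _ω ∈ (SAW.Zd.saws 2 n).filter (fun ω =>
          0 < n ∧
          (∀ i, 0 < i → i ≤ n → dist (Site.toComplex (u + ω i)) z < dist (Site.toComplex u) z) ∧
          (∀ i, i < n → dist (Site.toComplex (u + ω n)) z < dist (Site.toComplex (u + ω i)) z) ∧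
          dist (Site.toComplex (u + ω n)) z ≤ s ∧
          (∀ t, 0 < t → t < n →
            (∀ i, i < t → dist (Site.toComplex (u + ω t)) z < dist (Site.toComplex (u + ω i)) z) →
            (∀ j, t < j → j ≤ n → dist (Site.toComplex (u + ω j)) z < dist (Site.toComplex (u + ω t)) z) →
            s < dist (Site.toComplex (u + ω t)) z)),
          SAW.criticalFugacity ^ n) = 0 := by
  refine Finset.sum_eq_zero fun n _ => Finset.sum_eq_zero fun ω hω => ?_
  exfalso
  obtain ⟨hsaw, hn, hconf, -⟩ := Finset.mem_filter.1 hω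
  have h1 := dist_first_step hsaw hn u
  have hlt := hconf 1 one_pos (Nat.succ_le_of_lt hn)
  have htri := dist_triangle (Site.toComplex (u + ω 1)) z (Site.toComplex u)
  rw [dist_comm z] at htri
  linarith

/-- **Trivial regime: negative level.** For `s < 0` no end radius is `≤ s`: `D(u;s)[N] = 0`.
[folklore] -/
theorem rr_cb_eq_zero_of_neg (z : ℂ) (u : Site 2) (s : ℝ) (N : ℕ) (hs : s < 0) :
    (∑ n ∈ Finset.range (N + 1),
        ∑ _ω ∈ (SAW.Zd.saws 2 n).filter (fun ω =>
          0 < n ∧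
          (∀ i, 0 < i → i ≤ n → dist (Site.toComplex (u + ω i)) z < dist (Site.toComplex u) z) ∧
          (∀ i, i < n → dist (Site.toComplex (u + ω n)) z < dist (Site.toComplex (u + ω i)) z) ∧
          dist (Site.toComplex (u + ω n)) z ≤ s ∧
          (∀ t, 0 < t → t < n →
            (∀ i, i < t → dist (Site.toComplex (u + ω t)) z < dist (Site.toComplex (u + ω i)) z) →
            (∀ j, t < j → j ≤ n → dist (Site.toComplex (u + ω j)) z < dist (Site.toComplex (u + ω t)) z) →
            s < dist (Site.toComplex (u + ω t)) z)),
          SAW.criticalFugacity ^ n) = 0 := by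
  refine Finset.sum_eq_zero fun n _ => Finset.sum_eq_zero fun ω hω => ?_
  exfalso
  obtain ⟨-, -, -, -, hend, -⟩ := Finset.mem_filter.1 hω
  have := dist_nonneg (x := Site.toComplex (u + ω n)) (y := z)
  linarith

/-! ### The lattice floor -/

/-- **The lattice floor.** If the closed disc `|· - z| ≤ s` contains exactly one lattice point `v`
(`hv`), then the level-`s` members from `u` are exactly the self-avoiding walks from `u` to `v` of
positive length confined to the open disc of radius `dist (Site.toComplex u) z` about `z` after
time `0`: the end must be `v`; conversely every earlier vertex differs from `v` (self-avoidance),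
hence lies outside the closed disc, so the end is a strict record and no renewal time before the end
has radius `≤ s`.  Thus `D(u;s)[N] = Σ_{n ≤ N} #{ω : u → v confined, |ω| = n} · x_c^n`. [folklore] -/
theorem rr_cb_floor (z : ℂ) (u : Site 2) (s : ℝ) (N : ℕ) (v : Site 2)
    (hv : ∀ w : Site 2, dist (Site.toComplex w) z ≤ s ↔ w = v) :
    (∑ n ∈ Finset.range (N + 1),
        ∑ _ω ∈ (SAW.Zd.saws 2 n).filter (fun ω =>
          0 < n ∧
          (∀ i, 0 < i → i ≤ n → dist (Site.toComplex (u + ω i)) z < dist (Site.toComplex u) z) ∧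
          (∀ i, i < n → dist (Site.toComplex (u + ω n)) z < dist (Site.toComplex (u + ω i)) z) ∧
          dist (Site.toComplex (u + ω n)) z ≤ s ∧
          (∀ t, 0 < t → t < n →
            (∀ i, i < t → dist (Site.toComplex (u + ω t)) z < dist (Site.toComplex (u + ω i)) z) →
            (∀ j, t < j → j ≤ n → dist (Site.toComplex (u + ω j)) z < dist (Site.toComplex (u + ω t)) z) →
            s < dist (Site.toComplex (u + ω t)) z)),
          SAW.criticalFugacity ^ n) =
      ∑ n ∈ Finset.range (N + 1),
        ∑ _ω ∈ (SAW.Zd.saws 2 n).filter (fun ω =>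
          0 < n ∧
          (∀ i, 0 < i → i ≤ n → dist (Site.toComplex (u + ω i)) z < dist (Site.toComplex u) z) ∧
          u + ω n = v),
          SAW.criticalFugacity ^ n := by
  refine Finset.sum_congr rfl fun n _ => Finset.sum_congr (Finset.filter_congr fun ω hω => ?_)
    fun _ _ => rfl
  constructor
  · rintro ⟨hn, hconf, -, hend, -⟩
    exact ⟨hn, hconf, (hv _).1 hend⟩
  · rintro ⟨hn, hconf, hend⟩
    obtain ⟨-, -, -, hinj⟩ := SAW.Zd.mem_saws.1 hω
    have hearly : ∀ i, i < n → ¬ u + ω i = v := by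
      intro i hi h
      have hi' : ω i = ω n := add_left_cancel (h.trans hend.symm)
      have := hinj (by simp only [Set.mem_setOf_eq]; omega) (by simp only [Set.mem_setOf_eq]; omega) hi'
      omega
    exact ⟨hn, hconf, rr_cb_profile_floor (r := fun i => dist (Site.toComplex (u + ω i)) z)
      (atv := fun i => u + ω i = v) (fun i _ => hv (u + ω i)) hend hearly⟩

end Summit.CriticalPhenomena.SAWScalingLimit.Theorems.AnnularMassDecay.Radial

end
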